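import Summits.MatrixMultiplication.MatrixMultiplication.Theorems.LevelGradedCohnUmansLevelOneGL2DesignsHermitianLiftExponent

/-!
# The CM-Hermitian lift, records at small conductor: exponents `4/3`, `7/5`, `17/12` on the progressions `1 (mod 7, 11, 13)`
(wall-breaker axis `Hermitian unital constructions`, stub `stub_tangencySets` of the crux `LevelOneGL2Designs`,
stmt-MatrixMultiplication-14080, k7 — file 6)

Named instances of `…HermitianLiftExponent.inducedMatchings_cmLift` (`3/2 − 1/(r−1)` along `q ≡ 1 (mod r)`):

* `tangencySets_fourThirds_mod_seven` — tangency sets of `AG(2,p)` with `≥ c·p^{4/3}` points for all large primes `p ≡ 1 (mod 7)`;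
* `tangencySets_sevenFifths_mod_eleven` — `≥ c·p^{7/5}` for all large `p ≡ 1 (mod 11)` (the parabola lift through `ℚ(ζ₁₁)⁺` gives
  `13/10` there: `…TraceLiftThirteenTenths`, and Pohoata's theorem `3/2 − 2/(r−1) = 13/10`);
* `tangencySets_seventeenTwelfths_mod_thirteen` — `≥ c·p^{17/12}` for all large `p ≡ 1 (mod 13)`;
* `stubFormat_sevenFifths_mod_eleven` — the `p ≡ 1 (mod 11)` record in the stub's exact flag format.

As of this file these are the largest exponents in the tree on these three progressions.  Elementary given file 5; no definitions.
-/

-- the summit/problem path `MatrixMultiplication.MatrixMultiplication` is fixed by the tree layout (D-0017)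
set_option linter.dupNamespace false

noncomputable section

open Finset Matrix

namespace Summit.MatrixMultiplication.MatrixMultiplication.Theorems.LevelOneGL2Designs.HermitianLift

/-- **Exponent `4/3` on `p ≡ 1 (mod 7)`** (CM-Hermitian lift over `ℚ(ζ₇)`, degree `6`: `3/2 − 1/6`). [this project] -/
theorem tangencySets_fourThirds_mod_seven :
    ∃ c : ℝ, 0 < c ∧ ∃ q₀ : ℕ, ∀ p : ℕ, p.Prime → q₀ ≤ p → p % 7 = 1 →
      ∃ V : Finset (Fin 2 → ZMod p), c * (p : ℝ) ^ ((4 : ℝ) / 3) ≤ V.card ∧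
        ∀ v ∈ V, ∃ u : Fin 2 → ZMod p, u ≠ 0 ∧ ∀ w ∈ V, u ⬝ᵥ w = u ⬝ᵥ v → w = v := by
  obtain ⟨c, hc, q₀, h⟩ := inducedMatchings_cmLift 7 (by norm_num) (by norm_num)
  refine ⟨c, hc, q₀, fun p hp hp₀ hmod => ?_⟩
  have he : ((3 : ℝ) / 2 - 1 / (((7 : ℕ) : ℝ) - 1)) = (4 : ℝ) / 3 := by norm_num
  simpa only [he] using h p hp hp₀ hmod

/-- **Exponent `7/5` on `p ≡ 1 (mod 11)`** (CM-Hermitian lift over `ℚ(ζ₁₁)`, degree `10`: `3/2 − 1/10`; the real-subfield parabola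
lift gives `13/10` on the same primes). [this project] -/
theorem tangencySets_sevenFifths_mod_eleven :
    ∃ c : ℝ, 0 < c ∧ ∃ q₀ : ℕ, ∀ p : ℕ, p.Prime → q₀ ≤ p → p % 11 = 1 →
      ∃ V : Finset (Fin 2 → ZMod p), c * (p : ℝ) ^ ((7 : ℝ) / 5) ≤ V.card ∧
        ∀ v ∈ V, ∃ u : Fin 2 → ZMod p, u ≠ 0 ∧ ∀ w ∈ V, u ⬝ᵥ w = u ⬝ᵥ v → w = v := by
  obtain ⟨c, hc, q₀, h⟩ := inducedMatchings_cmLift 11 (by norm_num) (by norm_num)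
  refine ⟨c, hc, q₀, fun p hp hp₀ hmod => ?_⟩
  have he : ((3 : ℝ) / 2 - 1 / (((11 : ℕ) : ℝ) - 1)) = (7 : ℝ) / 5 := by norm_num
  simpa only [he] using h p hp hp₀ hmod

/-- **Exponent `17/12` on `p ≡ 1 (mod 13)`** (CM-Hermitian lift over `ℚ(ζ₁₃)`, degree `12`: `3/2 − 1/12`). [this project] -/
theorem tangencySets_seventeenTwelfths_mod_thirteen :
    ∃ c : ℝ, 0 < c ∧ ∃ q₀ : ℕ, ∀ p : ℕ, p.Prime → q₀ ≤ p → p % 13 = 1 →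
      ∃ V : Finset (Fin 2 → ZMod p), c * (p : ℝ) ^ ((17 : ℝ) / 12) ≤ V.card ∧
        ∀ v ∈ V, ∃ u : Fin 2 → ZMod p, u ≠ 0 ∧ ∀ w ∈ V, u ⬝ᵥ w = u ⬝ᵥ v → w = v := by
  obtain ⟨c, hc, q₀, h⟩ := inducedMatchings_cmLift 13 (by norm_num) (by norm_num)
  refine ⟨c, hc, q₀, fun p hp hp₀ hmod => ?_⟩
  have he : ((3 : ℝ) / 2 - 1 / (((13 : ℕ) : ℝ) - 1)) = (17 : ℝ) / 12 := by norm_num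
  simpa only [he] using h p hp hp₀ hmod

/-- **The `p ≡ 1 (mod 11)` record in the stub's flag format**: every large prime `p ≡ 1 (mod 11)` carries a strong representative
system of `AG(2,p)` (`f.1 ⬝ᵥ f'.2 = 1 ↔ f = f'`) with `≥ c·p^{7/5}` flags. [this project] -/
theorem stubFormat_sevenFifths_mod_eleven :
    ∃ c : ℝ, 0 < c ∧ ∃ q₀ : ℕ, ∀ p : ℕ, p.Prime → q₀ ≤ p → p % 11 = 1 →
      ∃ S : Finset ((Fin 2 → ZMod p) × (Fin 2 → ZMod p)),
        c * (p : ℝ) ^ ((7 : ℝ) / 5) ≤ S.card ∧ ∀ f ∈ S, ∀ f' ∈ S, (dotProduct f.1 f'.2 = 1 ↔ f = f') := by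
  obtain ⟨c, hc, q₀, h⟩ := stubFormat_cmLift_progression 11 (by norm_num) (by norm_num)
  refine ⟨c, hc, q₀, fun p hp hp₀ hmod => ?_⟩
  have he : ((3 : ℝ) / 2 - 1 / (((11 : ℕ) : ℝ) - 1)) = (7 : ℝ) / 5 := by norm_num
  simpa only [he] using h p hp hp₀ hmod

end Summit.MatrixMultiplication.MatrixMultiplication.Theorems.LevelOneGL2Designs.HermitianLift
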